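import Summits.NavierStokesRegularity.NavierStokesRegularity.Theorems.FilamentSkeletonRssSkeletonJ1LSplit
import Summits.NavierStokesRegularity.NavierStokesRegularity.Theorems.FilamentSkeletonRssSkeletonJ1RFrameDefs

/-!
# Route `FilamentSkeletonRss` · crux `SkeletonJ1R` (stmt-NavierStokesRegularity-23610) — STUB STATEMENTS of the registered line `streamline_kantorovich_R`
# (skeleton of record since 2026-08-29, lead `ns-fsr-lead-23610`): D `FlatOutputL` (shared with `lia_switchoff_degree_R`), F1 `LiaFrameExistsL`,
# F2 `LiaDefectL`, L `ReferenceInjectivityL`, K `KantorovichClosingL` (and the closing's output shape `FineFixedPointL`)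

Definitions only, `--supports stmt-NavierStokesRegularity-23610`; companion of `…SkeletonJ1RFrameDefs.lean` (the route-independent objects).  These are the
REGISTERED stub signatures of the crux (`ledger skeleton check`, 2026-08-29; RESHAPED the same day by the lead to the DATUM-SLICED frame `SlicedFrame` of `…FrameDefs` §5 — the changes w.r.t. the skeleton text cbdaf3778dcf are `AdmissibleFrame ↦ SlicedFrame` in the frame hypotheses and the split of stub F `LiaFrameL` into F1 `LiaFrameExistsL` ∧ F2 `LiaDefectL`, with K taking both): every stub helper file `Theorems/FilamentSkeletonRssSkeletonJ1R<Stub>.lean` proves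
`theorem stub_<x> : <Name>` with `<Name>` from THIS file, and the sorry-free skeleton imports both Defs files instead of restating them.  Texts otherwise VERBATIM the
registered skeleton `Cruxes/SkeletonJ1R/Lines/streamline_kantorovich_R.lean` (sha16 cbdaf3778dcf417e) §2 (`FlatOutputL`) and §3; they quantify over the split
files' `StraightDatum` / `NearStraightJ1G` (`…SkeletonJ1GSplit`) and `FlatJ1L` (`…SkeletonJ1LSplit`), hence the `Theses`-cone import (unavoidable: `FlatJ1L` is
the crux's own clause block).  Sizes / why-plausible / failure modes are in each docstring and in the line card `Lines/streamline_kantorovich_R.md`.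

All statements are `def … : Prop` and are NEVER asserted here.  HONEST FRAMING: stub statements for the ∃-side DECIDING crux of a HYPOTHETICAL
filament-type rotating-self-similar blow-up skeleton (MODEL rung, negative side); nothing here proves, refutes or moves any statement about Navier–Stokes
regularity; 23610 / 23320 / 23612 stay OPEN. [folklore]
-/

set_option linter.dupNamespace false -- `NavierStokesRegularity.NavierStokesRegularity` path/namespace repetition is the tree convention

noncomputable section

namespace Summit.NavierStokesRegularity.NavierStokesRegularity.Theorems.SkeletonJ1RFrame

open Set Function Filter MeasureTheory Real
open Literature.Analysis.FluidPDE
open Summit.NavierStokesRegularity.NavierStokesRegularity.Theorems.FilamentSkeletonRssSkeletonJ1GSplit (NearStraightJ1G StraightDatum)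
open Summit.NavierStokesRegularity.NavierStokesRegularity.Theorems.FilamentSkeletonRssSkeletonJ1LSplit (FlatJ1L)
open scoped InnerProductSpace Topology BigOperators

/-! ## §1 Stub D — the flat output (shared by both live lines; the registered skeleton §2 with the sliced frame) -/

/-- STUB D statement · FLAT OUTPUT (M; bookkeeping + one far-field estimate).  A FINE switched-tangent skeleton at `s = 1` with regular waists, in a
datum-sliced frame (`SlicedFrame`, reshape of the record's admissible frame), satisfies the flat clause block `FlatJ1L` and the near-straight regime `NearStraightJ1G` with `c := 0`, rigid unit cores
`Aa := 1` (`KA := 1`), `w :=` the TRUE slip, and datum-derived constants: on the crux ball the switch weight is `1`, so global switched tangency IS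
clause 9; tangent oscillation `≤ Rb` from tilt `≤ Rb/4` against the reference and reference tilt `≤ Rb/8` against `t j` (`SlicedReference`);
separation `(ρ/2 − 2Rb)√Γ`; chord–arc / box / waist-norm / tilt / cone clauses are inequalities on the fine class, `SlicedReference` and
`StraightDatum`; the unique zero of the TRUE slip off the ball needs `½⟪X, X′⟫ > |α|·|⟪e₃ × X, X′⟫| + |⟪u_X, X′⟫|` (centreline Biot–Savart bound
`|u_X(X j τ)| ≤ C√Γ log Γ` along near-straight separated skeletons). -/
def FlatOutputL : Prop :=
  ∀ (N : ℕ) (δd ρd Λd Rwd θd mw : ℝ) (p t : Fin N → EuclideanSpace ℝ (Fin 3)) (γ : Fin N → ℝ) (α : ℝ) (s₀ : Fin N → ℝ),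
    0 < N → 0 < δd → 0 < ρd → 0 < Rwd → 0 < θd → 0 < mw → StraightDatum N δd ρd Λd Rwd θd mw p t γ α s₀ →
    (∀ j k, j ≠ k → |⟪t j, t k⟫_ℝ| ≤ 1 - θd) →
    ∃ (δ ρ K Λ Rw cg θ₀ KA Rb₁ : ℝ), 0 < δ ∧ 0 < ρ ∧ 0 < Rw ∧ 0 < cg ∧ 0 < θ₀ ∧ 0 < Rb₁ ∧ 2 * K * ρ ≤ 1 ∧
      ∀ lam Rb : ℝ, 0 < lam → 0 < Rb → Rb ≤ Rb₁ → ∃ Γ₃ : ℝ, ∀ Γ : ℝ, Γ₃ ≤ Γ →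
        ∀ (x : Fin N → ℝ → EuclideanSpace ℝ (Fin 3)) (M : EuclideanSpace ℝ (Fin 3) → EuclideanSpace ℝ (Fin 3)),
          SlicedFrame Γ ρd lam Rb p t s₀ x M →
          ∀ X : Fin N → ℝ → EuclideanSpace ℝ (Fin 3),
            FineClass Γ δd Λd Rb γ α x X → SwitchedTangent Γ Rb γ α M 1 X → RegularWaist Γ ρd Rb γ α x M 1 X →
            ∃ (w : Fin N → ℝ → ℝ) (c : Fin N → ℝ) (Aa : Fin N → ℝ → ℝ),
              FlatJ1L N δ ρ K Λ Rw Rb cg θ₀ KA Γ γ α X w c Aa ∧ NearStraightJ1G N Λ Rb X w Aa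

/-! ## §2 Stubs F1, F2, L, K of the registered line and the closing's output shape (the registered skeleton §3 with the sliced frame, F split) -/

/-- STUB F1 statement · THE LIA FRAME AT CONTRACTION RATE `λ = 1` EXISTS (M; RESHAPE 2 of the lead, 2026-08-29: the v1 stub F `LiaFrameL` =
F1 ∧ F2 is split into its existence half F1 and its defect-rate half F2 `LiaDefectL`, so that each closes as a stub on its own).  For every
general-position straight datum there is a tolerance ceiling `Rb₁` such that for every `0 < Rb ≤ Rb₁` there is `Γ₁` with, for all `Γ ≥ Γ₁`, a
datum-sliced frame `(x, M)` (`SlicedFrame`, FrameDefs §5) whose reference is THE local-induction reference `IsLiaReference` (an IVP: global, unique —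
`liaReference_exists`; near-straightness by the bootstrap of `…SkeletonJ1RLiaBootstrap`: tilt `≤ A·Rb²·O(1) ≤ Rb/8`, curvature `O(Rb/√log Γ) ≤ Rb/2`
in `1/√Γ` units, separation `(ρ/2)√Γ` from the datum's; the arm model `M` with `λ = 1` is the explicit sliced blend of `(7/4)τ x′ − z`).  Why it
might fail: it cannot (sizes only); the honest risk is bookkeeping volume. -/
def LiaFrameExistsL : Prop :=
  ∀ (N : ℕ) (δd ρd Λd Rwd θd mw : ℝ) (p t : Fin N → EuclideanSpace ℝ (Fin 3)) (γ : Fin N → ℝ) (α : ℝ) (s₀ : Fin N → ℝ),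
    0 < N → 0 < δd → 0 < ρd → 0 < Rwd → 0 < θd → 0 < mw → StraightDatum N δd ρd Λd Rwd θd mw p t γ α s₀ →
    (∀ j k, j ≠ k → |⟪t j, t k⟫_ℝ| ≤ 1 - θd) →
    ∃ Rb₁ : ℝ, 0 < Rb₁ ∧ ∀ Rb : ℝ, 0 < Rb → Rb ≤ Rb₁ → ∃ Γ₁ : ℝ, ∀ Γ : ℝ, Γ₁ ≤ Γ →
      ∃ (x : Fin N → ℝ → EuclideanSpace ℝ (Fin 3)) (M : EuclideanSpace ℝ (Fin 3) → EuclideanSpace ℝ (Fin 3)),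
        IsLiaReference Γ Rb p t γ α s₀ x ∧ SlicedFrame Γ ρd 1 Rb p t s₀ x M

/-- STUB F2 statement · THE DEFECT RATE OF THE LIA FRAME (M–L; the defect half of the v1 stub F).  For every general-position straight datum there
is `Rb₁` such that for every `0 < Rb ≤ Rb₁` there are `Γ₁, C_d` with, for all `Γ ≥ Γ₁` and EVERY datum-sliced frame `(x, M)` at `λ = 1` whose
reference is the LIA reference, the switched normal defect of the reference itself obeys `‖swDefect(x) j τ‖ ≤ C_d (√Γ + |τ|) log log Γ / log Γ` — on
the closed final switched region the reference solves the full cut-off LIA balance, so the defect is `σ·`(Biot–Savart self-induction minus local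
induction `β_j x′×x″`, relative error `≍ log(ℓ/(μ√Γ))/log Γ ≍ log log Γ/log Γ` along an S-bend of curvature `≍ A|τ|/β_j`, whose nonlocal
self-induction at the waist cancels by oddness; the even C-bend driven by the `O(√Γ)` waist-normal ambient velocity contributes `O(√Γ/log Γ)`; the
partners' bends seen in the mutual field contribute relative `O(Rb²) + O(log log Γ/log Γ)`), and it VANISHES where `σ = 0` (the sliced model is
tangent to `x`: `SlicedModel.apply_ref`).  Why it might fail: only through the rate — a mis-identified logarithm in `liaCoeff` would make the
relative defect `O(1/log Γ)·log(…)` with a different constant but the same form; the form `(√Γ + |τ|)·log log Γ/log Γ` has slack.  Leans on: the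
tree's quantitative LIA reduction `SelectionBoxRJRung.nearStraight_liaReduction` (p-landed, lane 19175) and the self-induction tail / far-field
Biot–Savart bricks of `…SkeletonEquilibrium*`. -/
def LiaDefectL : Prop :=
  ∀ (N : ℕ) (δd ρd Λd Rwd θd mw : ℝ) (p t : Fin N → EuclideanSpace ℝ (Fin 3)) (γ : Fin N → ℝ) (α : ℝ) (s₀ : Fin N → ℝ),
    0 < N → 0 < δd → 0 < ρd → 0 < Rwd → 0 < θd → 0 < mw → StraightDatum N δd ρd Λd Rwd θd mw p t γ α s₀ →
    (∀ j k, j ≠ k → |⟪t j, t k⟫_ℝ| ≤ 1 - θd) →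
    ∃ Rb₁ : ℝ, 0 < Rb₁ ∧ ∀ Rb : ℝ, 0 < Rb → Rb ≤ Rb₁ → ∃ (Γ₁ Cd : ℝ), ∀ Γ : ℝ, Γ₁ ≤ Γ →
      ∀ (x : Fin N → ℝ → EuclideanSpace ℝ (Fin 3)) (M : EuclideanSpace ℝ (Fin 3) → EuclideanSpace ℝ (Fin 3)),
        IsLiaReference Γ Rb p t γ α s₀ x → SlicedFrame Γ ρd 1 Rb p t s₀ x M →
        ∀ j τ, ‖swDefect Γ Rb γ α M x j τ‖ ≤ Cd * (Real.sqrt Γ + |τ|) * Real.log (Real.log Γ) / Real.log Γ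

/-- STUB L statement · REFERENCE INJECTIVITY = THE INVERTIBILITY LEMMA FOR THE LINEARISED CORE OPERATOR AT THE LIA REFERENCE (L–XL; the judge's
`what_would_move_it`).  In the LIA frame at `λ = 1`, for all large `Γ`: a `C²` NORMAL variation `Y` of the reference with bounded `C²` size whose
LINEARISED switched normal defect `d/ds|₀ swDefect(x + sY)` is bounded by `L` pointwise on the whole line satisfies `‖Y j τ‖ ≤ K·L` everywhere,
`K = K(datum, Rb)` INDEPENDENT of `Γ`.  (The `HasDerivAt` witness avoids the junk value of `deriv`; `B` only makes the size qualitative-finite.)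
Content: `d swDefect = −L₁Y` with `L₁ = w∂_τ − σΩ_j m(μD)J − S_⊥ + (1−σ)·1 + (∇σ·Y)(v − M)_⊥`, `m` the thin-core Kelvin symbol (`m(κ*) = 0`,
`κ* ≈ 1.114`; folds `κ_f1 ≈ 0.31`, `κ_f2 ≈ 3.59`); bounded inverse band by band — LOW BAND (`k ≲ 1/ℓ`): the local-induction boundary value
problem `β_jσY″`-type with the four in-ball parameters per filament pinned by the flat degeneration `σ → 0⁺` of the collar (two conditions per arm
end; matching determinant nonzero at the reference), sup gain `≍ ℓ²/β_j = 8πRb²/γ_j`; RIPPLE BAND (`kμ ≈ κ*`): envelope equation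
`(w + Ωμ m′(κ*)) a′ + i w k* a = f`, purely imaginary zeroth-order coefficient ⇒ `|a|` is transported WITHOUT GROWTH at group speed `≍ Γ/μ`, gain
`≍ ℓμ/(Γ m′(κ*))`; WRINKLE BAND (`kμ ≫ 1`, `L₁ ≈ 𝒯 = w∂ − 2ΩJ − S`): bounded solutions pinned at the waist (indicial margin `−1/14`), gain `≤ 8/|tr S_⊥|`;
FAR/MODEL region: `(7/4)τ∂ + 1`, gain `1`; cross-band leakage through the `C^∞` switch collar and the slip profile `√Γ·W(τ/√Γ)` is
`O((μ/√Γ)^N)`.  Why it might fail: (a) a near-resonant sub-principal RIPPLE CAVITY (fold reflections f1/f2 closing a loop with O(1) round-trip gain at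
sparse `Γ`) would make `K` blow up along a sequence `Γ_n → ∞` — fatal under `∀ Γ ≥ Γ₂` (then only the cofinal variant survives, idea card
`cofinal-selection`); (b) the low-band matching determinant could vanish for some general-position data (then restrict the datum — the route
only needs ONE datum, `straightDatumGP_exists`); (c) `K` might be polynomial rather than uniform in `Γ` in these units (then the closing (K) needs
the sharper bookkeeping, not this statement). [Deuflhard, Newton Methods for Nonlinear Problems (2011) §1.2, Thm 2.1 (affine covariance);
Kelvin 1880 / Widnall–Bliss–Zalay 1971 (`κ*`); Fukumoto–Miyazaki 1991; Majda–Bertozzi 2002 §7.1–7.2; censuses g1/g2, AUDIT-r1g3 §3 of this crux] -/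
def ReferenceInjectivityL : Prop :=
  ∀ (N : ℕ) (δd ρd Λd Rwd θd mw : ℝ) (p t : Fin N → EuclideanSpace ℝ (Fin 3)) (γ : Fin N → ℝ) (α : ℝ) (s₀ : Fin N → ℝ),
    0 < N → 0 < δd → 0 < ρd → 0 < Rwd → 0 < θd → 0 < mw → StraightDatum N δd ρd Λd Rwd θd mw p t γ α s₀ →
    (∀ j k, j ≠ k → |⟪t j, t k⟫_ℝ| ≤ 1 - θd) →
    ∃ Rb₁ : ℝ, 0 < Rb₁ ∧ ∀ Rb : ℝ, 0 < Rb → Rb ≤ Rb₁ → ∃ (Γ₂ K : ℝ), 0 < K ∧ ∀ Γ : ℝ, Γ₂ ≤ Γ →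
      ∀ (x : Fin N → ℝ → EuclideanSpace ℝ (Fin 3)) (M : EuclideanSpace ℝ (Fin 3) → EuclideanSpace ℝ (Fin 3)),
        IsLiaReference Γ Rb p t γ α s₀ x → SlicedFrame Γ ρd 1 Rb p t s₀ x M →
        ∀ (Y : Fin N → ℝ → EuclideanSpace ℝ (Fin 3)) (B L : ℝ),
          (∀ j, ContDiff ℝ 2 (Y j)) → (∀ j τ, ⟪Y j τ, deriv (x j) τ⟫_ℝ = 0) →
          (∀ j τ, ‖Y j τ‖ + ‖deriv (Y j) τ‖ + ‖iteratedDeriv 2 (Y j) τ‖ ≤ B) →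
          (∀ j τ, ∃ D : EuclideanSpace ℝ (Fin 3),
              HasDerivAt (fun s : ℝ => swDefect Γ Rb γ α M (fun k σ => x k σ + s • Y k σ) j τ) D 0 ∧ ‖D‖ ≤ L) →
          ∀ j τ, ‖Y j τ‖ ≤ K * L

/-- THE OUTPUT SHAPE OF THE CLOSING (not a stub by itself): in EVERY LIA frame at `λ = 1`, for all large `Γ`, a FINE switched-tangent skeleton with
regular waists EXISTS at full switch-on `s = 1`.  (This is the heart's content before bookkeeping; it is the conclusion of stub K.) -/
def FineFixedPointL : Prop :=
  ∀ (N : ℕ) (δd ρd Λd Rwd θd mw : ℝ) (p t : Fin N → EuclideanSpace ℝ (Fin 3)) (γ : Fin N → ℝ) (α : ℝ) (s₀ : Fin N → ℝ),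
    0 < N → 0 < δd → 0 < ρd → 0 < Rwd → 0 < θd → 0 < mw → StraightDatum N δd ρd Λd Rwd θd mw p t γ α s₀ →
    (∀ j k, j ≠ k → |⟪t j, t k⟫_ℝ| ≤ 1 - θd) →
    ∃ Rb₁ : ℝ, 0 < Rb₁ ∧ ∀ Rb : ℝ, 0 < Rb → Rb ≤ Rb₁ → ∃ Γ₂ : ℝ, ∀ Γ : ℝ, Γ₂ ≤ Γ →
      ∀ (x : Fin N → ℝ → EuclideanSpace ℝ (Fin 3)) (M : EuclideanSpace ℝ (Fin 3) → EuclideanSpace ℝ (Fin 3)),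
        IsLiaReference Γ Rb p t γ α s₀ x → SlicedFrame Γ ρd 1 Rb p t s₀ x M →
        ∃ X : Fin N → ℝ → EuclideanSpace ℝ (Fin 3),
          FineClass Γ δd Λd Rb γ α x X ∧ SwitchedTangent Γ Rb γ α M 1 X ∧ RegularWaist Γ ρd Rb γ α x M 1 X

/-- STUB K statement · THE KANTOROVICH CLOSING (L–XL): frame existence + defect rate + reference injectivity ⟹ a fine switched-tangent skeleton with regular
waists at `s = 1` (v2: the frame hypothesis is fed as the two halves F1, F2).
Content: Banach space `E` = `C¹` normal displacement fields of `x` on the whole line in the weighted norm `‖Y‖_∞ + ℓ‖Y′‖_∞` (ball units,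
`ℓ = Rb√(Γ log Γ)`; the prover may refine the weight band by band), chart `Y ↦` the curve `x + Y` re-parametrised by arclength from its waist zero;
`Φ¹(X)` = arclength parametrisation, from its zero in the waist box, of the global UNSTABLE streamline of `switchedField … 1 X` (regular waists of the
reference: swirl pinning at `s = 1`, `σ = 1` on the waist box; outside `‖y‖ ≥ √2ℓ` the field is the model, whose unstable streamlines from the tube
are the reference arms); `G := I − Φ¹` is `C¹` with `DG(X) = I − DΦ¹(X)`, `DΦ¹` COMPACT (streamline of a field one derivative smoother than `X`) and
`DΦ¹(x) = 𝒯⁻¹(𝒯 − L₁)`, so `ker DG(x) = {0}` by (L) and `DG(x)` is invertible by the Fredholm alternative with ‖DG(x)⁻¹‖ computed from `K`; first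
Newton step `α₀ = ‖DG(x)⁻¹G(x)‖ ≲ (8πRb²/γ)·C_d ℓ log log Γ/log Γ = O(Rb³√Γ·log log Γ/√log Γ) = o(Rb√Γ)` by (F); affine-covariant Lipschitz
constant `ω ≲ 1/ℓ` on the low band (relative curvature change of the S-bend per unit displacement), `≍ 1/(ρ√Γ)·(log Γ)⁻¹`-weighted in the
interaction zone, ripple cross-terms weightless (constant-modulus transport); `h = α₀ω → 0`, Kantorovich ball radius `< 2α₀` inside the FINE
tolerances (position `Rb√Γ`, tilt `Rb/4`, curvature `Rb/√Γ`, waist slip slope `≥ 3/2 + δ/2` from `7/4 − O(Rb²)`), and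
`Literature.Analysis.Calculus.NewtonKantorovich_holds` gives the zero `X = Φ¹(X)`: unit speed, globally switched-tangent, through the waist zero,
escaping along the model arms, slip signs from the unstable/arm structure; regular waists persist from the reference (open conditions at `s = 1`).
Why it might fail: (a) `Φ¹` must be single-valued and `C¹` on a whole `2α₀`-ball about `x` — a skeleton in the ball whose switched field has a
second zero in a waist box, or whose unstable streamline leaves the injective tube before the model takes over, breaks the chart (the regular-waist
and tube margins `ρ√Γ/16 ≫ α₀` are the bet); (b) the Lipschitz constant of `DΦ¹` in the interaction zone carries `(log Γ)²`-type losses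
(`h ≲ C/(log Γ)²` with `C` in the hundreds: `Γ₂` astronomically large but finite — harmless for `∀ Γ ≥ Γ₂`, fatal only if the loss is a POWER of Γ);
(c) uniform-in-Γ `K` from (L) is in sup norm — the closing must upgrade to `C¹` by interpolation through the equation. [Kantorovich 1948;
Deuflhard 2011 Thm 2.1; Fredholm alternative (Mathlib: `Module.End` / compact operators); `NewtonKantorovich_holds`, `NewtonKantorovichUniqueness_holds`
(tree, Literature/Analysis/Calculus)] -/
def KantorovichClosingL : Prop :=
  LiaFrameExistsL → LiaDefectL → ReferenceInjectivityL → FineFixedPointL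

/-! ## §3 Reshape 3 (lead g0, 2026-08-29): stub L split as CORE PINNING (stub) + far pinning (real proof) -/

/-- STUB L-core statement · CORE PINNING = REFERENCE INJECTIVITY ON THE CLOSED SWITCHED REGION ONLY (the XL heart of stub L after reshape 3).
Verbatim the statement `ReferenceInjectivityL` except that the conclusion `‖Y_j τ‖ ≤ K·L` is asserted only at parameters whose reference point
lies in the CLOSED final switched region `‖x_j τ‖² ≤ 2ℓ²` (`ℓ = Rb√(Γ log Γ)`: ball + collar).  The complement — the pure model region, where the
switched field IS the sliced model and the linearised switched defect is the explicit transport operator `−Y − (7/4)τ·Y′_⊥ + O(|τ|‖x″‖)·Y` — is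
pinned with gain `2` from the collar exit by the LANDED `…SkeletonJ1RFarPinning` (`far_pinning_pos/neg`), and `ReferenceInjectivityL` follows from
this statement by a REAL proof (`…SkeletonJ1RReferenceInjectivityOfCore.referenceInjectivityL_of_core`, `K ↦ 2K + 2`).
Content (lead's L-notes §5–§7, `Cruxes/SkeletonJ1R/Lines/streamline_kantorovich_R_L-notes.md`): the near-kernel of the in-ball operator is the
`4N`-dimensional tangent space of the LIA-reference family (datum-line translations and tilts, each dressed with its cheap S-bend response; the
global rotation is one of them) — NOT the bare affine modes; every such direction is pinned by the model region through the thin TURNING LAYER of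
the collar where `σβ_j ≍ (transport)²` (`σ ≍ Rb²`, width `≍ ℓ/log²(1/Rb)`), in which `|Y′|` is conserved up to a phase and the outgoing fast
(dispersive) component has amplitude `≍ (layer width)·|Y′|`; the resulting sup-gain is `K ≍ C(datum)·log(1/Rb)`, uniform in `Γ`.  Everything
of stiffness `≫` transport (all in-ball wavelengths, factor `Rb⁻²`) is pinned inside the ball with gain `8πRb²/γ_j`.  Why it might fail: as for
`ReferenceInjectivityL` ((a) ripple cavity, (b) matching determinant, (c) polynomial-in-Γ losses) — this IS that statement minus its far part.
(route-posited stub statement; not a Literature fact) -/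
def CorePinningL : Prop :=
  ∀ (N : ℕ) (δd ρd Λd Rwd θd mw : ℝ) (p t : Fin N → EuclideanSpace ℝ (Fin 3)) (γ : Fin N → ℝ) (α : ℝ) (s₀ : Fin N → ℝ),
    0 < N → 0 < δd → 0 < ρd → 0 < Rwd → 0 < θd → 0 < mw → StraightDatum N δd ρd Λd Rwd θd mw p t γ α s₀ →
    (∀ j k, j ≠ k → |⟪t j, t k⟫_ℝ| ≤ 1 - θd) →
    ∃ Rb₁ : ℝ, 0 < Rb₁ ∧ ∀ Rb : ℝ, 0 < Rb → Rb ≤ Rb₁ → ∃ (Γ₂ K : ℝ), 0 < K ∧ ∀ Γ : ℝ, Γ₂ ≤ Γ →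
      ∀ (x : Fin N → ℝ → EuclideanSpace ℝ (Fin 3)) (M : EuclideanSpace ℝ (Fin 3) → EuclideanSpace ℝ (Fin 3)),
        IsLiaReference Γ Rb p t γ α s₀ x → SlicedFrame Γ ρd 1 Rb p t s₀ x M →
        ∀ (Y : Fin N → ℝ → EuclideanSpace ℝ (Fin 3)) (B L : ℝ),
          (∀ j, ContDiff ℝ 2 (Y j)) → (∀ j τ, ⟪Y j τ, deriv (x j) τ⟫_ℝ = 0) →
          (∀ j τ, ‖Y j τ‖ + ‖deriv (Y j) τ‖ + ‖iteratedDeriv 2 (Y j) τ‖ ≤ B) →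
          (∀ j τ, ∃ D : EuclideanSpace ℝ (Fin 3),
              HasDerivAt (fun s : ℝ => swDefect Γ Rb γ α M (fun k σ => x k σ + s • Y k σ) j τ) D 0 ∧ ‖D‖ ≤ L) →
          ∀ j τ, ‖x j τ‖ ^ 2 ≤ 2 * (Rb * Real.sqrt (Γ * Real.log Γ)) ^ 2 → ‖Y j τ‖ ≤ K * L

/-! ## §4 Reshape 4 (lead g2, 2026-08-29): stub F2 in RATE-B currency `(√Γ + |τ|)/√(log Γ)` and K re-pointed to it -/

/-- STUB F2-B statement · THE DEFECT RATE OF THE LIA FRAME, RATE B (reshape 4 of the lead, 2026-08-29).  Verbatim `LiaDefectL` except for the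
RATE: the switched normal defect of the LIA reference obeys `‖swDefect(x) j τ‖ ≤ C_d (√Γ + |τ|)/√(log Γ)` (instead of
`C_d (√Γ + |τ|) log log Γ/log Γ`).  This is the CANCELLATION-FREE rate (lead g0's F2-notes "RATE B", lead g2's analysis): the self strand's
local-induction error with the `½ log Γ` of `liaCoeff` costs `O(√Γ/log Γ)` from the `O(√Γ)` waist-normal ambient velocity plus
`O(Rb(√Γ + |τ|)/√log Γ)` from the S-bend's LINEAR curvature growth across the ball (no oddness used), and each partner's ambient-vs-actual
mismatch costs `O(Rb√Γ/√log Γ)` (displacement `≍ Rb²·(reach)` seen through the `1/ℓ` arm decay).  RATE A (`LiaDefectL`) additionally needs the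
oddness of the S-bend about each waist (the far-arm self-induction and the partner's cubic displacement cancel at leading order) and implies
RATE B for large `Γ`; the Kantorovich closing needs only RATE B (first Newton step `α₀ ≍ (8πRb²/γ)·C_d ℓ/√log Γ = O(Rb³√Γ)` inside the fine
tolerance `Rb√Γ`, `h = α₀ω ≍ Rb²/√log Γ → 0`), whence `KantorovichClosingBL` below.  PROVED: `…SkeletonJ1RLiaDefectB.stub_liaDefectBL`
(lead g2; chain S1–S4, E1–E2, P1–P2, G, A1, B0–B2).  Why it might fail: it cannot any more (sizes only). (route-posited stub statement;
not a Literature fact) -/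
def LiaDefectBL : Prop :=
  ∀ (N : ℕ) (δd ρd Λd Rwd θd mw : ℝ) (p t : Fin N → EuclideanSpace ℝ (Fin 3)) (γ : Fin N → ℝ) (α : ℝ) (s₀ : Fin N → ℝ),
    0 < N → 0 < δd → 0 < ρd → 0 < Rwd → 0 < θd → 0 < mw → StraightDatum N δd ρd Λd Rwd θd mw p t γ α s₀ →
    (∀ j k, j ≠ k → |⟪t j, t k⟫_ℝ| ≤ 1 - θd) →
    ∃ Rb₁ : ℝ, 0 < Rb₁ ∧ ∀ Rb : ℝ, 0 < Rb → Rb ≤ Rb₁ → ∃ (Γ₁ Cd : ℝ), ∀ Γ : ℝ, Γ₁ ≤ Γ →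
      ∀ (x : Fin N → ℝ → EuclideanSpace ℝ (Fin 3)) (M : EuclideanSpace ℝ (Fin 3) → EuclideanSpace ℝ (Fin 3)),
        IsLiaReference Γ Rb p t γ α s₀ x → SlicedFrame Γ ρd 1 Rb p t s₀ x M →
        ∀ j τ, ‖swDefect Γ Rb γ α M x j τ‖ ≤ Cd * (Real.sqrt Γ + |τ|) / Real.sqrt (Real.log Γ)

/-- STUB K-B statement · THE KANTOROVICH CLOSING fed with the RATE-B defect (reshape 4 of the lead, 2026-08-29): verbatim `KantorovichClosingL` with
`LiaDefectL` replaced by `LiaDefectBL` in the hypothesis (the closing's first Newton step only needs `C_d ℓ/√log Γ = o(Rb√Γ)`-type smallness, which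
RATE B supplies; see `LiaDefectBL`).  Content, why-plausible and failure modes: as for `KantorovichClosingL`. (route-posited stub statement; not a
Literature fact) -/
def KantorovichClosingBL : Prop :=
  LiaFrameExistsL → LiaDefectBL → ReferenceInjectivityL → FineFixedPointL

/-! ## §5 Reshape 4′ (lead g2 adopting tenure g31's collar-C¹ repair, 2026-08-29): defect measured in the collar-C¹ norm; F2 gains a collar derivative rate -/

/-- L-core′: `CorePinningL` with the linearised switched defect given as a FUNCTION `Df` (its `HasDerivAt` witness at every parameter), bounded by
`L` everywhere AND with `ℓ·‖∂_τ Df_j‖ ≤ L` on the COLLAR `ℓ² ≤ ‖x_j τ‖² ≤ 2ℓ²` (`ℓ = Rb√(Γ log Γ)`); conclusion as before on the closed switched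
region.  Typed by tenure g31 (memo `L-core-EDGE-RESONANCE-tenure-g31.md` bd24fc42fed31dd4: the sup-norm typing `CorePinningL` has no Γ-uniform `K`
by the flat-edge resonance of the collar; the `C¹` collar norm defuses it by one integration by parts); adopted by the lead (reshape 4′).
(route-posited stub statement; not a Literature fact) -/
def CorePinningL1 : Prop :=
  ∀ (N : ℕ) (δd ρd Λd Rwd θd mw : ℝ) (p t : Fin N → EuclideanSpace ℝ (Fin 3)) (γ : Fin N → ℝ) (α : ℝ) (s₀ : Fin N → ℝ),
    0 < N → 0 < δd → 0 < ρd → 0 < Rwd → 0 < θd → 0 < mw → StraightDatum N δd ρd Λd Rwd θd mw p t γ α s₀ →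
    (∀ j k, j ≠ k → |⟪t j, t k⟫_ℝ| ≤ 1 - θd) →
    ∃ Rb₁ : ℝ, 0 < Rb₁ ∧ ∀ Rb : ℝ, 0 < Rb → Rb ≤ Rb₁ → ∃ (Γ₂ K : ℝ), 0 < K ∧ ∀ Γ : ℝ, Γ₂ ≤ Γ →
      ∀ (x : Fin N → ℝ → EuclideanSpace ℝ (Fin 3)) (M : EuclideanSpace ℝ (Fin 3) → EuclideanSpace ℝ (Fin 3)),
        IsLiaReference Γ Rb p t γ α s₀ x → SlicedFrame Γ ρd 1 Rb p t s₀ x M →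
        ∀ (Y : Fin N → ℝ → EuclideanSpace ℝ (Fin 3)) (B L : ℝ) (Df : Fin N → ℝ → EuclideanSpace ℝ (Fin 3)),
          (∀ j, ContDiff ℝ 2 (Y j)) → (∀ j τ, ⟪Y j τ, deriv (x j) τ⟫_ℝ = 0) →
          (∀ j τ, ‖Y j τ‖ + ‖deriv (Y j) τ‖ + ‖iteratedDeriv 2 (Y j) τ‖ ≤ B) →
          (∀ j τ, HasDerivAt (fun s : ℝ => swDefect Γ Rb γ α M (fun k σ => x k σ + s • Y k σ) j τ) (Df j τ) 0) →
          (∀ j τ, ‖Df j τ‖ ≤ L) →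
          (∀ j τ, (Rb * Real.sqrt (Γ * Real.log Γ)) ^ 2 ≤ ‖x j τ‖ ^ 2 → ‖x j τ‖ ^ 2 ≤ 2 * (Rb * Real.sqrt (Γ * Real.log Γ)) ^ 2 →
              ∃ D' : EuclideanSpace ℝ (Fin 3), HasDerivAt (Df j) D' τ ∧ Rb * Real.sqrt (Γ * Real.log Γ) * ‖D'‖ ≤ L) →
          ∀ j τ, ‖x j τ‖ ^ 2 ≤ 2 * (Rb * Real.sqrt (Γ * Real.log Γ)) ^ 2 → ‖Y j τ‖ ≤ K * L

/-- L′: `ReferenceInjectivityL` with the same collar-C¹ defect hypothesis; conclusion everywhere (glue `…ReferenceInjectivityOfCoreL1.referenceInjectivityL1_of_core :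
CorePinningL1 → ReferenceInjectivityL1`). (route-posited stub statement; not a Literature fact) -/
def ReferenceInjectivityL1 : Prop :=
  ∀ (N : ℕ) (δd ρd Λd Rwd θd mw : ℝ) (p t : Fin N → EuclideanSpace ℝ (Fin 3)) (γ : Fin N → ℝ) (α : ℝ) (s₀ : Fin N → ℝ),
    0 < N → 0 < δd → 0 < ρd → 0 < Rwd → 0 < θd → 0 < mw → StraightDatum N δd ρd Λd Rwd θd mw p t γ α s₀ →
    (∀ j k, j ≠ k → |⟪t j, t k⟫_ℝ| ≤ 1 - θd) →
    ∃ Rb₁ : ℝ, 0 < Rb₁ ∧ ∀ Rb : ℝ, 0 < Rb → Rb ≤ Rb₁ → ∃ (Γ₂ K : ℝ), 0 < K ∧ ∀ Γ : ℝ, Γ₂ ≤ Γ →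
      ∀ (x : Fin N → ℝ → EuclideanSpace ℝ (Fin 3)) (M : EuclideanSpace ℝ (Fin 3) → EuclideanSpace ℝ (Fin 3)),
        IsLiaReference Γ Rb p t γ α s₀ x → SlicedFrame Γ ρd 1 Rb p t s₀ x M →
        ∀ (Y : Fin N → ℝ → EuclideanSpace ℝ (Fin 3)) (B L : ℝ) (Df : Fin N → ℝ → EuclideanSpace ℝ (Fin 3)),
          (∀ j, ContDiff ℝ 2 (Y j)) → (∀ j τ, ⟪Y j τ, deriv (x j) τ⟫_ℝ = 0) →
          (∀ j τ, ‖Y j τ‖ + ‖deriv (Y j) τ‖ + ‖iteratedDeriv 2 (Y j) τ‖ ≤ B) →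
          (∀ j τ, HasDerivAt (fun s : ℝ => swDefect Γ Rb γ α M (fun k σ => x k σ + s • Y k σ) j τ) (Df j τ) 0) →
          (∀ j τ, ‖Df j τ‖ ≤ L) →
          (∀ j τ, (Rb * Real.sqrt (Γ * Real.log Γ)) ^ 2 ≤ ‖x j τ‖ ^ 2 → ‖x j τ‖ ^ 2 ≤ 2 * (Rb * Real.sqrt (Γ * Real.log Γ)) ^ 2 →
              ∃ D' : EuclideanSpace ℝ (Fin 3), HasDerivAt (Df j) D' τ ∧ Rb * Real.sqrt (Γ * Real.log Γ) * ‖D'‖ ≤ L) →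
          ∀ j τ, ‖Y j τ‖ ≤ K * L

/-- STUB F2-d statement · THE COLLAR DERIVATIVE RATE OF THE DEFECT OF THE LIA FRAME, RATE B (reshape 4′): on the collar `ℓ² ≤ ‖x_j τ‖² ≤ 2ℓ²`
(`ℓ = Rb√(Γ log Γ)`) the switched normal defect of the reference is differentiable along the reference with `ℓ·‖∂_τ swDefect(x) j τ‖ ≤ C_d(√Γ + |τ|)/√(log Γ)`
— the companion of `LiaDefectBL` that the collar-`C¹` Kantorovich closing needs (the defect varies on the scale `≍ |τ| ≍ ℓ` in the collar: the S-bend curvature, the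
cutoff and the partners' Lorentzians there all vary on that scale; the derivative falls on the strand integrals, whose kernels are differentiable with the
`…SkeletonEquilibriumBiotSavartDifferentiable` bricks).  Why it might fail: only through the rate, as for `LiaDefectBL`. (route-posited stub statement; not a
Literature fact) -/
def LiaDefectDerivBL : Prop :=
  ∀ (N : ℕ) (δd ρd Λd Rwd θd mw : ℝ) (p t : Fin N → EuclideanSpace ℝ (Fin 3)) (γ : Fin N → ℝ) (α : ℝ) (s₀ : Fin N → ℝ),
    0 < N → 0 < δd → 0 < ρd → 0 < Rwd → 0 < θd → 0 < mw → StraightDatum N δd ρd Λd Rwd θd mw p t γ α s₀ →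
    (∀ j k, j ≠ k → |⟪t j, t k⟫_ℝ| ≤ 1 - θd) →
    ∃ Rb₁ : ℝ, 0 < Rb₁ ∧ ∀ Rb : ℝ, 0 < Rb → Rb ≤ Rb₁ → ∃ (Γ₁ Cd : ℝ), ∀ Γ : ℝ, Γ₁ ≤ Γ →
      ∀ (x : Fin N → ℝ → EuclideanSpace ℝ (Fin 3)) (M : EuclideanSpace ℝ (Fin 3) → EuclideanSpace ℝ (Fin 3)),
        IsLiaReference Γ Rb p t γ α s₀ x → SlicedFrame Γ ρd 1 Rb p t s₀ x M →
        ∀ j τ, (Rb * Real.sqrt (Γ * Real.log Γ)) ^ 2 ≤ ‖x j τ‖ ^ 2 → ‖x j τ‖ ^ 2 ≤ 2 * (Rb * Real.sqrt (Γ * Real.log Γ)) ^ 2 →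
          ∃ D' : EuclideanSpace ℝ (Fin 3), HasDerivAt (fun σ' : ℝ => swDefect Γ Rb γ α M x j σ') D' τ ∧
            Rb * Real.sqrt (Γ * Real.log Γ) * ‖D'‖ ≤ Cd * (Real.sqrt Γ + |τ|) / Real.sqrt (Real.log Γ)

/-- STUB K-B′ statement · THE KANTOROVICH CLOSING from `C²`-weighted displacements to COLLAR-`C¹`-weighted defects (reshape 4′): fed by F1, the
RATE-B defect `LiaDefectBL` (landed), its collar derivative rate `LiaDefectDerivBL`, and the collar-`C¹` injectivity `ReferenceInjectivityL1`.
(route-posited stub statement; not a Literature fact) -/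
def KantorovichClosingBL1 : Prop :=
  LiaFrameExistsL → LiaDefectBL → LiaDefectDerivBL → ReferenceInjectivityL1 → FineFixedPointL

end Summit.NavierStokesRegularity.NavierStokesRegularity.Theorems.SkeletonJ1RFrame

end
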